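import Literature.AlgebraicGeometry.Resolution.CompositeValuations
import Mathlib.FieldTheory.IntermediateField.Adjoin.Algebra
import Mathlib.RingTheory.AlgebraicIndependent.TranscendenceBasis
import Mathlib.Combinatorics.Pigeonhole
import Mathlib.RingTheory.PrincipalIdealDomain
import HarnessLib

/-!
# Finite rank of valuations on fields of finite transcendence degree over a field of finite rank

Topic: `Literature/AlgebraicGeometry/Resolution` (valued function fields). PROVED: the
finiteness of the rank used in the reduction step Lemma 5.3 of F.-V. Kuhlmann, *Elimination of
ramification I*, Trans. AMS 362 (2010) = arXiv:1003.5678 (p. 18: the field "`k₁`, finitely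
generated over the prime field", "its relative algebraic closure `k` in `K` … Lemma 2.7
[= Cor. 2.7] shows that `(k,v)`, `(k(t), v)` … have finite rank"), RELATIVE to an arbitrary
valued subfield `k` of finite rank (the sibling `FiniteRankOverPrimeField.lean` treats the prime
subfield `⊥ ⊆ Ω`, met by the overrings in at most two ways; `CompositeValuations.lean` the
trivially valued case `k ⊆ V`): the rank of `(K, O)` is bounded by
`(rank of (k, O ∩ k) + 1) · (tr.deg_k K + 1)`, which lets the finiteness be pushed up a tower
`ℚ or 𝔽_p ⊆ k₀(S) ⊆ k(t)` one storey at a time (`GeneralizedStabilityFiniteRankProofs.lean`).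

* `algebraicIndependent_of_chain_of_comap_le` — **chain lemma over a valued subfield**: if
  `S₀ < ⋯ < S_n` are valuation rings of `K` with the same trace on a subfield `k` and
  `x_i ∈ S_{i+1} ∖ S_i`, then the `x_i` are algebraically independent over `k` (Bourbaki,
  *Alg. Comm.* VI §10 no. 3, proof of Thm. 1 / Cor. 1, run relative to `k`: a would-be relation
  has a unique term of largest value, because no power `x_j^r` (`r ≥ 1`) has the `S_j`-value of
  a constant — such a constant would lie in `S_{j+1} ∩ k = S_j ∩ k`).
* `finite_overrings_of_algebraicIndependent_bounded`,
  `finite_overrings_of_finite_comap_of_isAlgebraic_adjoin` — **rank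
  `(K, O) ≤ (rank (k, O ∩ k) + 1)(tr.deg_k K + 1)`**: if `O ∩ k` has finitely many overrings and
  `K` is algebraic over `k(s)` for a finite `s`, then `O` has finitely many overrings
  (pigeonhole on the traces of a long chain).
* `finite_overrings_rat` — a valuation ring of `ℚ` has at most two overrings (there is no
  chain `S₀ < S₁ < S₂`: the traces on `ℤ` of the maximal ideals of `S₀ ≤ S₁ ≠ ℚ` are the same
  prime `(p)`, and then `S₀ = S₁`); `finite_overrings_of_finite` — finite fields.

## Sources

* N. Bourbaki, *Algèbre commutative, Chapitres 5 à 7*, Ch. VI §10 no. 3 (Thm. 1, Cor. 1: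
  `rang ≤ rang rationnel ≤ degré de transcendance` over a subfield); O. Zariski, P. Samuel,
  *Commutative Algebra* II, Ch. VI §10, Thm. 22 Cor. (rank of a valuation of a function field).
  [folklore]
* F.-V. Kuhlmann, loc. cit., Cor. 2.7 and the proof of Lemma 5.3 (p. 18) — where it is used.
-/

noncomputable section

open IsLocalRing

namespace Literature.AlgebraicGeometry.Resolution

universe u v

/-! ### Chains of valuation rings with constant trace on a subfield -/

section Chain

variable {k K : Type*} [Field k] [Field K] [Algebra k K]

open Finset in
/-- **Chain lemma over a valued subfield.** Let `S₀ < S₁ < ⋯ < S_n` be valuation rings of `K`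
which all have THE SAME trace on the subfield `k` (it suffices that `S_n ∩ k ⊆ S₀`), and
`x_i ∈ S_{i+1} ∖ S_i`. Then the `x_i` are algebraically independent over `k`. (For `k ⊆ S₀`,
i.e. `k` trivially valued, this is `algebraicIndependent_of_chain`; in general the constancy
of the trace replaces it: if `S_i`-value of `x_i^r` were the value of some `c ∈ k`, then
`c ∈ S_{i+1} ∩ k = S_i ∩ k` although its `S_i`-value exceeds `1`.) Consequently a valuation of
`K` has rank at most `(rank of its trace on k + 1) · (tr.deg_k K + 1)`. [folklore] -/
theorem algebraicIndependent_of_chain_of_comap_le {n : ℕ} (S : Fin (n + 1) → ValuationSubring K)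
    (hS : StrictMono S)
    (hk : ∀ c : k, algebraMap k K c ∈ S (Fin.last n) → algebraMap k K c ∈ S 0)
    (x : Fin n → K) (hx : ∀ i, x i ∈ S i.succ) (hx' : ∀ i, x i ∉ S i.castSucc) :
    AlgebraicIndependent k x := by
  classical
  have hx0 : ∀ i, x i ≠ 0 := fun i h0 => hx' i (h0 ▸ (S _).zero_mem)
  -- valuations of the `x i` w.r.t. the members of the chain
  have hone : ∀ i j : Fin n, i < j → (S j.castSucc).valuation (x i) = 1 := by
    intro i j hij
    have hle : S i.succ ≤ S j.castSucc := hS.monotone (Fin.succ_le_castSucc_iff.mpr hij)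
    have hle' : S i.castSucc ≤ S j.castSucc := hS.monotone (by
      rw [Fin.castSucc_le_castSucc_iff]; exact hij.le)
    apply le_antisymm ((ValuationSubring.valuation_le_one_iff _ _).mpr (hle (hx i)))
    have hinv : (x i)⁻¹ ∈ S j.castSucc :=
      hle' (((S i.castSucc).mem_or_inv_mem (x i)).resolve_left (hx' i))
    rw [← ValuationSubring.valuation_le_one_iff, map_inv₀, inv_le_one₀] at hinv
    · exact hinv
    · exact (Valuation.pos_iff _).mpr (hx0 i)
  have hgt : ∀ j : Fin n, 1 < (S j.castSucc).valuation (x j) := by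
    intro j
    rw [← not_le, ValuationSubring.valuation_le_one_iff]; exact hx' j
  -- constancy of the trace: no power `x_j^r`, `r ≥ 1`, has the `S_j`-value of a constant
  have hkj : ∀ (j : Fin n) (c : k), algebraMap k K c ∈ S j.succ → algebraMap k K c ∈ S j.castSucc :=
    fun j c hc => hS.monotone (Fin.zero_le _) (hk c (hS.monotone (Fin.le_last _) hc))
  have hkey : ∀ (j : Fin n) (r : ℕ), 0 < r → ∀ c : k,
      (S j.castSucc).valuation (x j) ^ r ≠ (S j.castSucc).valuation (algebraMap k K c) := by
    intro j r hr c heq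
    set w := (S j.castSucc).valuation with hw
    have hc0 : algebraMap k K c ≠ 0 := by
      intro h0
      rw [h0, map_zero, pow_eq_zero_iff hr.ne'] at heq
      exact (hx0 j) ((Valuation.zero_iff _).mp heq)
    -- `u = x_j^r / c` is a unit of `S_j`
    have hu : w (x j ^ r / algebraMap k K c) = 1 := by
      rw [map_div₀, map_pow, heq, div_self ((Valuation.ne_zero_iff _).mpr hc0)]
    have huinv : (x j ^ r / algebraMap k K c)⁻¹ ∈ S j.castSucc := by
      rw [← ValuationSubring.valuation_le_one_iff, map_inv₀, ← hw, hu, inv_one]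
    -- hence `c = x_j^r · u⁻¹ ∈ S_{j+1}`, so `c ∈ S_j`: contradiction with `w(x_j) > 1`
    have hcS : algebraMap k K c ∈ S j.succ := by
      have : algebraMap k K c = x j ^ r * (x j ^ r / algebraMap k K c)⁻¹ := by
        rw [inv_div, mul_div_cancel₀ _ (pow_ne_zero _ (hx0 j))]
      rw [this]
      exact mul_mem (pow_mem (hx j) r) (hS.monotone (Fin.castSucc_lt_succ).le huinv)
    have hc1 : w (algebraMap k K c) ≤ 1 := (ValuationSubring.valuation_le_one_iff _ _).mpr (hkj j c hcS)
    rw [← heq, pow_le_one_iff hr.ne'] at hc1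
    exact absurd (hgt j) (not_lt.mpr hc1)
  -- monomials
  let mon : (Fin n →₀ ℕ) → K := fun m => ∏ i, x i ^ m i
  have hmon0 : ∀ m, mon m ≠ 0 := fun m => by
    simp only [mon]; exact prod_ne_zero_iff.mpr fun i _ => pow_ne_zero _ (hx0 i)
  -- terms `c • mon m`, `c' • mon m'` with `m ≠ m'` and `c, c' ≠ 0` have distinct values
  have hdist : ∀ (m m' : Fin n →₀ ℕ) (c c' : k), m ≠ m' → c ≠ 0 → c' ≠ 0 →
      (S 0).valuation (algebraMap k K c * mon m) ≠ (S 0).valuation (algebraMap k K c' * mon m') := by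
    intro m m' c c' hmm' hc hc' heq
    let D : Finset (Fin n) := univ.filter fun i => m i ≠ m' i
    have hD : D.Nonempty := by
      by_contra hD
      rw [not_nonempty_iff_eq_empty, filter_eq_empty_iff] at hD
      exact hmm' (Finsupp.ext fun i => not_not.mp (hD (mem_univ i)))
    set j := D.max' hD with hj
    have hjD : m j ≠ m' j := (mem_filter.mp (D.max'_mem hD)).2
    have htail : ∀ i, j < i → m i = m' i := by
      intro i hi
      by_contra hne
      exact not_le.mpr hi (D.le_max' i (mem_filter.mpr ⟨mem_univ _, hne⟩))
    -- pass to the valuation `w` of `S j.castSucc`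
    set w := (S j.castSucc).valuation with hw
    have h0j : S 0 ≤ S j.castSucc := hS.monotone (Fin.zero_le _)
    have heq' : w (algebraMap k K c * mon m) = w (algebraMap k K c' * mon m') := by
      have := congrArg ((S 0).mapOfLE (S j.castSucc) h0j) heq
      rwa [ValuationSubring.mapOfLE_valuation_apply,
        ValuationSubring.mapOfLE_valuation_apply] at this
    have hsplit : ∀ μ : Fin n →₀ ℕ, w (mon μ) =
        w (x j) ^ μ j * ∏ i ∈ univ.erase j, w (x i) ^ μ i := by
      intro μ
      simp only [mon, map_prod, map_pow]
      exact (mul_prod_erase univ (fun i => w (x i) ^ μ i) (mem_univ j)).symm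
    have herase : ∏ i ∈ univ.erase j, w (x i) ^ m i = ∏ i ∈ univ.erase j, w (x i) ^ m' i := by
      refine prod_congr rfl fun i hi => ?_
      rcases lt_or_gt_of_ne (ne_of_mem_erase hi) with h | h
      · rw [hone i j h, one_pow, one_pow]
      · rw [htail i h]
    have hT : (∏ i ∈ univ.erase j, w (x i) ^ m' i) ≠ 0 :=
      prod_ne_zero_iff.mpr fun i _ => pow_ne_zero _ ((Valuation.ne_zero_iff _).mpr (hx0 i))
    rw [map_mul, map_mul, hsplit, hsplit, herase, ← mul_assoc, ← mul_assoc] at heq'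
    have h2 := mul_right_cancel₀ hT heq'
    -- `w(c) w(x_j)^{m_j} = w(c') w(x_j)^{m'_j}` with `m_j ≠ m'_j`
    have hwc : w (algebraMap k K c) ≠ 0 :=
      (Valuation.ne_zero_iff _).mpr ((map_ne_zero _).mpr hc)
    have hwc' : w (algebraMap k K c') ≠ 0 :=
      (Valuation.ne_zero_iff _).mpr ((map_ne_zero _).mpr hc')
    have hxj0 : w (x j) ≠ 0 := (Valuation.ne_zero_iff _).mpr (hx0 j)
    rcases lt_or_gt_of_ne hjD with hlt | hlt
    · -- `w(x_j)^(m'_j - m_j) = w(c / c')`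
      apply hkey j (m' j - m j) (Nat.sub_pos_of_lt hlt) (c / c')
      rw [map_div₀, map_div₀, eq_div_iff hwc']
      have : m' j = m j + (m' j - m j) := by omega
      rw [this, pow_add, ← mul_assoc, mul_comm (w (algebraMap k K c'))] at h2
      -- h2 : w c * w(x_j)^{m_j} = w(x_j)^{m_j} * w c' * w(x_j)^{d}  — rearrange
      have h3 := h2
      rw [mul_comm (w (algebraMap k K c)), mul_assoc] at h3
      have h4 := mul_left_cancel₀ (pow_ne_zero _ hxj0) h3
      rw [h4, mul_comm]
    · apply hkey j (m j - m' j) (Nat.sub_pos_of_lt hlt) (c' / c)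
      rw [map_div₀, map_div₀, eq_div_iff hwc]
      have : m j = m' j + (m j - m' j) := by omega
      rw [this, pow_add, ← mul_assoc, mul_comm (w (algebraMap k K c))] at h2
      have h3 := h2.symm
      rw [mul_comm (w (algebraMap k K c')), mul_assoc] at h3
      have h4 := mul_left_cancel₀ (pow_ne_zero _ hxj0) h3
      rw [h4, mul_comm]
  -- an algebraic relation would be a sum of terms with pairwise distinct values
  rw [algebraicIndependent_iff]
  intro p hp
  by_contra hp0
  have hsupp : p.support.Nonempty := MvPolynomial.support_nonempty.mpr hp0
  obtain ⟨d₀, hd₀, hmax⟩ :=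
    p.support.exists_max_image (fun d => (S 0).valuation (algebraMap k K (p.coeff d) * mon d)) hsupp
  have hterm0 : (S 0).valuation (algebraMap k K (p.coeff d₀) * mon d₀) ≠ 0 :=
    (Valuation.ne_zero_iff _).mpr (mul_ne_zero
      ((map_ne_zero _).mpr (MvPolynomial.mem_support_iff.mp hd₀)) (hmon0 d₀))
  have hsum : (S 0).valuation (MvPolynomial.aeval x p) =
      (S 0).valuation (algebraMap k K (p.coeff d₀) * mon d₀) := by
    rw [MvPolynomial.aeval_def, MvPolynomial.eval₂_eq']
    apply Valuation.map_sum_eq_of_lt _ hd₀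
    intro d hd
    rw [mem_sdiff, mem_singleton] at hd
    exact lt_of_le_of_ne (hmax d hd.1) (hdist d d₀ _ _ hd.2
      (MvPolynomial.mem_support_iff.mp hd.1) (MvPolynomial.mem_support_iff.mp hd₀))
  rw [hp, map_zero] at hsum
  exact hterm0 hsum.symm

end Chain

/-! ### Finite rank from a finite-rank trace and finite transcendence degree -/

section Count

variable {k K : Type*} [Field k] [Field K] [Algebra k K]

/-- **Finite rank.** If the trace `O ∩ k` of a valuation ring `O` of `K` on the subfield `k` has
finitely many overrings and the algebraically independent families of `K | k` have bounded
size `≤ d`, then `O` has finitely many overrings (at most `(#overrings of O ∩ k)·(d+1)`): in a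
longer chain of overrings, `d + 2` members would have the same trace on `k` (pigeonhole), and
`algebraicIndependent_of_chain_of_comap_le` would produce `d + 1` algebraically independent
elements. [folklore] -/
theorem finite_overrings_of_algebraicIndependent_bounded (O : ValuationSubring K)
    [hfin : Finite {S' : ValuationSubring k // O.comap (algebraMap k K) ≤ S'}] (d : ℕ)
    (hd : ∀ (n : ℕ) (x : Fin n → K), AlgebraicIndependent k x → n ≤ d) :
    Finite {S : ValuationSubring K // O ≤ S} := by
  classical
  haveI := Fintype.ofFinite {S' : ValuationSubring k // O.comap (algebraMap k K) ≤ S'}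
  set r := Fintype.card {S' : ValuationSubring k // O.comap (algebraMap k K) ≤ S'} with hr
  by_contra hinf
  rw [not_finite_iff_infinite] at hinf
  -- a chain of `r (d+1) + 1` overrings
  obtain ⟨s, hs⟩ := Infinite.exists_subset_card_eq {S : ValuationSubring K // O ≤ S} (r * (d + 1) + 1)
  -- their traces on `k`
  let res : {S : ValuationSubring K // O ≤ S} →
      {S' : ValuationSubring k // O.comap (algebraMap k K) ≤ S'} :=
    fun S => ⟨S.1.comap (algebraMap k K), fun c hc => S.2 hc⟩
  obtain ⟨y, -, hy⟩ := Finset.exists_lt_card_fiber_of_mul_lt_card_of_maps_to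
    (s := s) (t := Finset.univ) (f := res) (fun S _ => Finset.mem_univ _) (n := d + 1)
    (by rw [Finset.card_univ, ← hr, hs]; omega)
  -- `d + 2` overrings with the same trace `y`
  obtain ⟨t, hts, htcard⟩ := Finset.exists_subset_card_eq (Nat.succ_le_of_lt hy)
  let e := t.orderEmbOfFin htcard
  let T : Fin (d + 1 + 1) → ValuationSubring K := fun i => (e i).1
  have hTm : StrictMono T := fun i j hij => by
    have h := e.strictMono hij
    exact h
  have hTres : ∀ i, (T i).comap (algebraMap k K) = y.1 := by
    intro i
    have hmem : e i ∈ t := t.orderEmbOfFin_mem htcard i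
    have := (Finset.mem_filter.mp (hts hmem)).2
    exact congrArg Subtype.val this
  have hlt : ∀ i : Fin (d + 1), T i.castSucc < T i.succ := fun i => hTm (Fin.castSucc_lt_succ)
  choose x hx hx' using fun i => SetLike.exists_of_lt (hlt i)
  have hk : ∀ c : k, algebraMap k K c ∈ T (Fin.last (d + 1)) → algebraMap k K c ∈ T 0 := by
    intro c hc
    rw [← ValuationSubring.mem_comap, hTres, ← hTres 0, ValuationSubring.mem_comap] at hc
    exact hc
  have hai := algebraicIndependent_of_chain_of_comap_le T hTm hk x hx hx'
  have := hd _ x hai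
  omega

open scoped IntermediateField.algebraAdjoinAdjoin in
/-- **Finite rank over a finitely generated field**: if `O ∩ k` has finitely many overrings in
`k` and `K` is algebraic over `k(s)` for a finite set `s`, then `O` has finitely many overrings
(`tr.deg_k K ≤ #s`). [folklore] -/
theorem finite_overrings_of_finite_comap_of_isAlgebraic_adjoin (O : ValuationSubring K)
    [Finite {S' : ValuationSubring k // O.comap (algebraMap k K) ≤ S'}] (s : Finset K)
    [halg : Algebra.IsAlgebraic (IntermediateField.adjoin k (s : Set K)) K] :
    Finite {S : ValuationSubring K // O ≤ S} := by
  haveI : Algebra.IsAlgebraic (Algebra.adjoin k (s : Set K)) K :=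
    Algebra.IsAlgebraic.trans (R := Algebra.adjoin k (s : Set K))
      (S := IntermediateField.adjoin k (s : Set K)) (A := K)
  have htr : Algebra.trdeg k K ≤ (s.card : Cardinal) := by
    simpa using Algebra.IsAlgebraic.trdeg_le_cardinalMk k (s : Set K) (A := K)
  refine finite_overrings_of_algebraicIndependent_bounded (k := k) O s.card fun n x hx => ?_
  have h1 := hx.lift_cardinalMk_le_trdeg
  have h2 := h1.trans (Cardinal.lift_le.mpr htr)
  rw [Cardinal.mk_fin] at h2
  simpa using h2

end Count

/-! ### The prime fields have finite rank -/

section PrimeField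

/-- A finite field has finitely many valuation rings (indeed only `⊤`). [folklore] -/
theorem finite_valuationSubring_of_finite (k : Type*) [Field k] [Finite k] :
    Finite (ValuationSubring k) :=
  Finite.of_injective (fun S : ValuationSubring k => (S : Set k)) SetLike.coe_injective

/-- In particular a valuation ring of a finite field has finitely many overrings. [folklore] -/
theorem finite_overrings_of_finite (k : Type*) [Field k] [Finite k] (P : ValuationSubring k) :
    Finite {S : ValuationSubring k // P ≤ S} :=
  haveI := finite_valuationSubring_of_finite k
  Subtype.finite

/-- If `S₀ ≤ S₁` are valuation rings, the maximal ideal of `S₁` is contained in that of `S₀`: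
an element of `S₁`-value `< 1` has `S₀`-value `< 1`. [folklore] -/
theorem valuation_lt_one_of_valuationSubring_le {K : Type*} [Field K] {S₀ S₁ : ValuationSubring K} (h : S₀ ≤ S₁)
    {x : K} (hx : S₁.valuation x < 1) : S₀.valuation x < 1 := by
  by_contra hcon
  rw [not_lt] at hcon
  by_cases hx0 : x = 0
  · rw [hx0, map_zero] at hcon
    exact not_lt.mpr hcon zero_lt_one
  have hinv : x⁻¹ ∈ S₁ := by
    apply h
    rw [← ValuationSubring.valuation_le_one_iff, map_inv₀, inv_le_one₀ ((Valuation.pos_iff _).mpr hx0)]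
    exact hcon
  rw [← ValuationSubring.valuation_le_one_iff, map_inv₀,
    inv_le_one₀ ((Valuation.pos_iff _).mpr hx0)] at hinv
  exact not_lt.mpr hinv hx

/-- The trace `𝔪(S) ∩ ℤ` of the maximal ideal of a valuation ring `S` of `ℚ` (a prime ideal of
`ℤ`) consists of the integers of `S`-value `< 1`. [folklore] -/
theorem mem_comap_maximalIdeal_int_iff (S : ValuationSubring ℚ) (a : ℤ) :
    a ∈ (IsLocalRing.maximalIdeal S).comap (Int.castRingHom S) ↔ S.valuation (a : ℚ) < 1 := by
  rw [Ideal.mem_comap, ValuationSubring.valuation_lt_one_iff, eq_intCast, SubringClass.coe_intCast]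

/-- A valuation ring of `ℚ` in which every non-zero integer is a unit is `ℚ`. [folklore] -/
theorem eq_top_of_comap_maximalIdeal_int_eq_bot (S : ValuationSubring ℚ)
    (h : (IsLocalRing.maximalIdeal S).comap (Int.castRingHom S) = ⊥) : S = ⊤ := by
  rw [eq_top_iff]
  intro x _
  have hden : S.valuation (x.den : ℚ) = 1 := by
    apply le_antisymm ((ValuationSubring.valuation_le_one_iff _ _).mpr (by
      exact_mod_cast (natCast_mem S x.den)))
    rw [← not_lt]
    intro hlt
    have hmem : (x.den : ℤ) ∈ (IsLocalRing.maximalIdeal S).comap (Int.castRingHom S) := by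
      rw [mem_comap_maximalIdeal_int_iff]; exact_mod_cast hlt
    rw [h, Ideal.mem_bot] at hmem
    exact x.den_ne_zero (by exact_mod_cast hmem)
  have hnum : S.valuation (x.num : ℚ) ≤ 1 :=
    (ValuationSubring.valuation_le_one_iff _ _).mpr (by exact_mod_cast (intCast_mem S x.num))
  rw [← ValuationSubring.valuation_le_one_iff, ← Rat.num_div_den x, map_div₀, hden, div_one]
  exact hnum

/-- **A valuation ring of `ℚ` has at most two overrings** (itself and `ℚ`; the valuation rings
of `ℚ` are `ℚ` and the localizations `ℤ_(p)`), in the form: there is no chain `S₀ < S₁ < S₂`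
of valuation rings of `ℚ`. [folklore] -/
theorem not_lt_lt_valuationSubring_rat (S₀ S₁ S₂ : ValuationSubring ℚ) (h₀₁ : S₀ < S₁)
    (h₁₂ : S₁ < S₂) : False := by
  -- the traces of the maximal ideals on `ℤ`
  set I₀ : Ideal ℤ := (IsLocalRing.maximalIdeal S₀).comap (Int.castRingHom S₀) with hI₀def
  set I₁ : Ideal ℤ := (IsLocalRing.maximalIdeal S₁).comap (Int.castRingHom S₁) with hI₁def
  -- `S₁ ≠ ℚ`, so some prime `p` generates the trace of `𝔪(S₁)` on `ℤ`
  have hS₁ : S₁ ≠ ⊤ := ne_top_of_lt h₁₂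
  have hI₁ : I₁ ≠ ⊥ := fun h => hS₁ (eq_top_of_comap_maximalIdeal_int_eq_bot S₁ h)
  obtain ⟨p, hp⟩ := Submodule.IsPrincipal.principal I₁
  change I₁ = Ideal.span {p} at hp
  have hp0 : p ≠ 0 := fun h0 => hI₁ (by rw [hp, h0, Ideal.span_singleton_eq_bot])
  have hpI : (Ideal.span {p}).IsPrime := by rw [← hp]; infer_instance
  have hpprime : Prime p := (Ideal.span_singleton_prime hp0).mp hpI
  -- the trace of `𝔪(S₀)` on `ℤ` contains `(p)` and is proper, hence equals `(p)`
  have hI₀₁ : I₁ ≤ I₀ := fun a ha => by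
    rw [hI₁def, mem_comap_maximalIdeal_int_iff] at ha
    rw [hI₀def, mem_comap_maximalIdeal_int_iff]
    exact valuation_lt_one_of_valuationSubring_le h₀₁.le ha
  have hmax : I₁.IsMaximal := IsPrime.to_maximal_ideal hI₁
  have hI₀ : I₀ = I₁ :=
    (hmax.eq_of_le (Ideal.comap_isPrime _ _).ne_top hI₀₁).symm
  -- an element of `S₁ ∖ S₀`
  obtain ⟨y, hy₁, hy₀⟩ := SetLike.exists_of_lt h₀₁
  have hden0 : (y.den : ℚ) ≠ 0 := by exact_mod_cast y.den_ne_zero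
  -- its denominator lies in `𝔪(S₀) ∩ ℤ = (p)`
  have hden : (y.den : ℤ) ∈ I₀ := by
    rw [hI₀def, mem_comap_maximalIdeal_int_iff]
    by_contra hge
    rw [not_lt] at hge
    have h1 : S₀.valuation (y.den : ℚ) = 1 := le_antisymm
      ((ValuationSubring.valuation_le_one_iff _ _).mpr (by exact_mod_cast natCast_mem S₀ y.den))
      (by exact_mod_cast hge)
    apply hy₀
    rw [← ValuationSubring.valuation_le_one_iff, ← Rat.num_div_den y, map_div₀]
    rw [h1, div_one]
    exact (ValuationSubring.valuation_le_one_iff _ _).mpr (by exact_mod_cast intCast_mem S₀ y.num)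
  rw [hI₀, hp, Ideal.mem_span_singleton] at hden
  -- so `p ∤ num y`, i.e. `num y` is a unit of `S₁`, while `den y ∈ 𝔪(S₁)`: `y ∉ S₁`
  have hcop : IsCoprime y.num (y.den : ℤ) := by
    rw [Int.isCoprime_iff_gcd_eq_one]
    exact y.reduced
  have hnum : ¬ p ∣ y.num := fun hdvd => hpprime.not_unit (hcop.isUnit_of_dvd' hdvd hden)
  have hnum1 : S₁.valuation (y.num : ℚ) = 1 := by
    apply le_antisymm ((ValuationSubring.valuation_le_one_iff _ _).mpr
      (by exact_mod_cast intCast_mem S₁ y.num))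
    rw [← not_lt, ← mem_comap_maximalIdeal_int_iff, ← hI₁def, hp, Ideal.mem_span_singleton]
    exact hnum
  have hden1 : S₁.valuation (y.den : ℚ) < 1 := by
    have : ((y.den : ℤ) : ℚ) = (y.den : ℚ) := by push_cast; rfl
    rw [← this, ← mem_comap_maximalIdeal_int_iff, ← hI₁def, hp, Ideal.mem_span_singleton]
    exact hden
  have hy1 : 1 < S₁.valuation y := by
    conv_rhs => rw [← Rat.num_div_den y]
    rw [map_div₀, hnum1, one_lt_div₀ ((Valuation.pos_iff _).mpr hden0)]
    · exact hden1
  exact absurd ((ValuationSubring.valuation_le_one_iff _ _).mpr hy₁) (not_le.mpr hy1)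

/-- **Valuation rings of `ℚ` have finite rank**: finitely many (at most two) overrings.
[folklore] -/
theorem finite_overrings_rat (P : ValuationSubring ℚ) : Finite {S : ValuationSubring ℚ // P ≤ S} := by
  classical
  by_contra hinf
  rw [not_finite_iff_infinite] at hinf
  obtain ⟨s, hs⟩ := Infinite.exists_subset_card_eq {S : ValuationSubring ℚ // P ≤ S} 3
  -- sort the three overrings into a chain (overrings are totally ordered)
  let e := s.orderIsoOfFin hs
  exact not_lt_lt_valuationSubring_rat (e 0).1.1 (e 1).1.1 (e 2).1.1
    (e.strictMono (by decide)) (e.strictMono (by decide))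

end PrimeField

end Literature.AlgebraicGeometry.Resolution
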